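import Mathlib

/-!
# Abelian STPP census, tier `τ = 5/2`: a kernel-replayable certificate checker for the crux `ShapeExclusionTE`
(definitions and specification vocabulary)

Cell mm-stpp (rung F-M1), route `AbelianSTPPCensus`, item `ShapeExclusionTE` (stmt-MatrixMultiplication-19759):
«every shape list with `≥ 2` members that is `SieveAdmissible M` and `Beats (5/2) M` at an order `M ≤ 127` has
`M ∈ {111,120,121,124,125,126,127}` and contains one of the registered residual sub-multisets» — the exhaustive
shape-level census of record (planner `feas_scan.py`, rule set vM) replayed INSIDE THE KERNEL.

This file contains only definitions, no claims: a reflective checker (`teCheck` / `teBatch`, evaluated by `decide`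
with kernel reduction, standard axioms) and the predicates in which its soundness is stated
(`AbelianSTPPCensusTECert{Knapsack,State,Search,Wlog,Bridge}.lean`; kernel evaluations in `…TECertEval{A,B,C,D}.lean`;
the crux in `AbelianSTPPCensusShapeExclusionTE.lean`).  Implementation A (eng-1), independent of `feas_scan.py`; the
seat's reference model `calc/te_ref4.py` reproduces the residual list of record in exact arithmetic.

* values (O5): `Beats` compares `M` with `Σ V_i^{5/6}` over `ℝ`; the checker uses the integer table
  `qOf V ≥ 100·V^{5/6}` (certified by `100^6·V^5 ≤ (qOf V)^6`, exact at the sixth powers `V = 1, 64`), so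
  `Beats ⇒ 100·M < Σ qOf V_i`, and a node with `100·M < Σ q` must contain a registered residual (`resid`);
* symmetry (O1): the constraints are symmetric in the members and covariant under permuting the three coordinates of
  all members simultaneously, so the member of maximal volume is taken first and sorted (`a ≥ b ≥ c`), and the others
  are enumerated along the fixed tier list `mkTiers M` (equal volume per tier, volumes descending; inside a tier from
  the position of the previous member on);
* shape table (O2): `tableOK` = U1, single-member Neumann, U13 isolation (clauses 1, 2, 5 of `SieveAdmissible`);
  the candidate triples are enumerated once (`tierTriples`, filtered at the largest order `127`) and shared;
* node filters (O3, extension-monotone): U2, U11 per member (running minima of the sizes), U14 with its tightness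
  clause read contrapositively (`dab = V - ab + 1` unless `c ≤ gcd(V,M)`), volume eligibility of a tier;
* completion bound (O4): the remaining members have volumes `≤ V` (current tier) and total pair-product sum
  `≤ budget` (five linear consequences of U14/U11); `row_V[budget]` is an exact unbounded-knapsack optimum over the
  items `(ab+bc+ca, qOf V')`, `V' ≤ V` (binary-splitting passes, budgets `≤ Bmax = 200`), and the node is closed when
  `Σq + row_V[budget] ≤ 100·M`.
Orders are certified in chunks (`teCheck M lo hi`: maximal-member volume in `[lo,hi)`; `teBatch lo n`: whole orders
`lo … lo+n-1` sharing one row table) sized for the kernel's memory budget.  All arithmetic is branch-free `Nat`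
arithmetic (`+`, `∸`, `*`, `/`, `%`, `gcd`, `Nat.beq`, `Nat.ble`) evaluated with GMP; a test `x ≤ y` is written as the
excess `x ∸ y = 0`.  WHAT THIS IS NOT: no statement about STPP families or `ω` — arithmetic on shape lists only.
-/

-- single-conjunct summit: the mandated namespace repeats `MatrixMultiplication`.
set_option linter.dupNamespace false

namespace Summit.MatrixMultiplication.MatrixMultiplication.Theorems.TECert

/-- Fixed-point scale: member values `V^{5/6}` are bounded above by `qOf V / K` with `K = 100`. -/
def K : ℕ := 100

/-- `qtab[V] = ⌈100 · V^{5/6}⌉` for `V = 0, …, 127` (exact at `V = 1` and `V = 64 = 2^6`, where `100·V^{5/6}` is an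
integer); certified in the proof files through `K^6 · V^5 ≤ qtab[V]^6` (`qtabOK`). -/
def qtab : List ℕ :=
  [0, 100, 179, 250, 318, 383, 446, 507, 566, 625, 682, 738, 794, 848, 902, 956, 1008, 1061, 1112, 1164, 1214, 1265,
    1315, 1364, 1414, 1463, 1511, 1559, 1607, 1655, 1702, 1750, 1796, 1843, 1890, 1936, 1982, 2027, 2073, 2118, 2163, 2208,
    2253, 2298, 2342, 2387, 2431, 2475, 2518, 2562, 2606, 2649, 2692, 2735, 2778, 2821, 2864, 2906, 2948, 2991, 3033, 3075,
    3117, 3159, 3200, 3242, 3284, 3325, 3366, 3408, 3449, 3490, 3531, 3571, 3612, 3653, 3693, 3734, 3774, 3814, 3854, 3895,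
    3935, 3975, 4014, 4054, 4094, 4134, 4173, 4213, 4252, 4291, 4331, 4370, 4409, 4448, 4487, 4526, 4565, 4603, 4642, 4681,
    4719, 4758, 4796, 4835, 4873, 4911, 4950, 4988, 5026, 5064, 5102, 5140, 5178, 5215, 5253, 5291, 5329, 5366, 5404, 5441,
    5479, 5516, 5553, 5591, 5628, 5665]

/-- The certified integer upper bound `K · V^{5/6} ≤ qOf V`: the table value for `V ≤ 127`, else the trivial `K · V`. -/
def qOf (V : ℕ) : ℕ := qtab.getD V (K * V)

/-- The certificate for `qtab`: `K^6 · V^5 ≤ (qOf V)^6` for every `V < 128` (so `V^{5/6} ≤ qOf V / K`). -/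
def qtabOK : Bool := (List.range 128).all fun V => decide (K ^ 6 * V ^ 5 ≤ qOf V ^ 6)

/-- Budget cap of the knapsack rows (the completion bound is only consulted for budgets `≤ Bmax`; larger budgets never
prune — in the census of record every consulted budget is `≤ 189`). -/
def Bmax : ℕ := 200

/-- `[¬ (f ≤ g)]` as a natural number, branch-free (`1 - (g + 1 - f)` with truncated subtraction). -/
def notLe (f g : ℕ) : ℕ := 1 - (g + 1 - f)

/-- A member shape with its data at order `M`: sizes `a, b, c`, volume `V = abc`, pair products `u = ab`, `v = bc`,
`w = ca`, value bound `q = qOf V`, and the sharpened U14 offsets `dab = V - u + [¬ c ≤ gcd(V,M)]`,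
`dbc = V - v + [¬ a ≤ gcd(V,M)]`, `dca = V - w + [¬ b ≤ gcd(V,M)]` (the U14 sum of a rotation can equal `M` only if a
common divisor of `V` and `M` is at least the size of the free member, i.e. only if `gcd(V,M)` is). -/
structure SRec where
  /-- first set size -/ a : ℕ
  /-- second set size -/ b : ℕ
  /-- third set size -/ c : ℕ
  /-- volume `abc` -/ V : ℕ
  /-- `ab` -/ u : ℕ
  /-- `bc` -/ v : ℕ
  /-- `ca` -/ w : ℕ
  /-- value bound `qOf V` -/ q : ℕ
  /-- sharpened U14 offset for the `ab`-rotation -/ dab : ℕ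
  /-- sharpened U14 offset for the `bc`-rotation -/ dbc : ℕ
  /-- sharpened U14 offset for the `ca`-rotation -/ dca : ℕ

/-- The record of the shape `(a, b, c)` at order `M`. -/
def mkRec (M a b c : ℕ) : SRec where
  a := a
  b := b
  c := c
  V := a * b * c
  u := a * b
  v := b * c
  w := c * a
  q := qOf (a * b * c)
  dab := a * b * c - a * b + notLe c (Nat.gcd (a * b * c) M)
  dbc := a * b * c - b * c + notLe a (Nat.gcd (a * b * c) M)
  dca := a * b * c - c * a + notLe b (Nat.gcd (a * b * c) M)

/-- The shape-table test (O2), as «sum of excesses = 0»: U1 `abc ≤ M`, single-member Neumann `a(b+c-1) ≤ M` and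
rotations, and the isolation bounds `abc + a ≤ M`, `abc + b ≤ M`, `abc + c ≤ M` (U13, valid whenever the family has a
second member). -/
def tableOK (M a b c : ℕ) : Bool :=
  Nat.beq ((a * b * c - M) + (a * (b + c - 1) - M) + (b * (c + a - 1) - M) + (c * (a + b - 1) - M) +
    (a * b * c + a - M) + (a * b * c + b - M) + (a * b * c + c - M)) 0

/-- The candidate shapes of volume exactly `V`: all `(a, b, c)` with `abc = V` (enumerated over `a ∣ V`, `b ∣ V / a`,
`c = V / a / b`) that pass the table test at the LARGEST order `127` — a superset of every order's table, shared by
all orders. -/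
def tierTriples (V : ℕ) : List (ℕ × ℕ × ℕ) :=
  (List.range V).flatMap fun a' =>
    if V % (a' + 1) = 0 then
      (List.range (V / (a' + 1))).filterMap fun b' =>
        if V / (a' + 1) % (b' + 1) = 0 ∧ tableOK 127 (a' + 1) (b' + 1) (V / (a' + 1) / (b' + 1)) = true then
          some (a' + 1, b' + 1, V / (a' + 1) / (b' + 1))
        else none
    else []

/-- The knapsack items of volume `V`: the pair-product sums `ab + bc + ca` of the candidate shapes, deduplicated. -/
def tierUs (V : ℕ) : List ℕ := ((tierTriples V).map fun t => t.1 * t.2.1 + t.2.1 * t.2.2 + t.2.2 * t.1).dedup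

/-- One 0/1-knapsack pass with an item of weight `kU` and value `kq` over a row indexed by the budget:
`row'[b] = row[b]` for `b < kU` and `row'[b] = max (row[b]) (row[b - kU] + kq)` for `b ≥ kU` (the maximum is written
branch-free as `x + (y + kq - x)`). -/
def knapPass (row : List ℕ) (kU kq : ℕ) : List ℕ :=
  row.take kU ++ List.zipWith (fun x y => x + (y + kq - x)) (row.drop kU) row

/-- Unbounded-knapsack insertion of the item `(U, q)` by binary splitting: passes with `(kU, kq)` for
`k = k₀, 2k₀, 4k₀, …` while `kU ≤ Bmax` (first argument = fuel for the doublings). -/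
def knapAdd (U q : ℕ) : ℕ → ℕ → List ℕ → List ℕ
  | 0, _, row => row
  | fuel + 1, k, row =>
    if 1 ≤ U ∧ k * U ≤ Bmax then knapAdd U q fuel (2 * k) (knapPass row (k * U) (k * q)) else row

/-- Insert all items of volume `V` (weights `tierUs V`, common value `qOf V`) into a row. -/
def addTier (V : ℕ) (row : List ℕ) : List ℕ :=
  (tierUs V).foldl (fun r U => knapAdd U (qOf V) 10 1 r) row

/-- A volume tier of the precomputed data: the volume `V`, the cumulative knapsack row for volumes `≤ V`, and the
candidate shapes of volume `V`. -/
structure RowRec where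
  /-- the volume -/ V : ℕ
  /-- `row_V[b]` bounds `Σ qOf V'` over multisets of candidate shapes of volumes `V' ≤ V` with `Σ (ab+bc+ca) ≤ b` -/ row : List ℕ
  /-- `tierTriples V` -/ triples : List (ℕ × ℕ × ℕ)

/-- The row of the most recent tier (the zero row of length `Bmax + 1` initially). -/
def headRow : List RowRec → List ℕ
  | [] => List.replicate (Bmax + 1) 0
  | r :: _ => r.row

/-- The precomputed tiers in DESCENDING order of volume: `rowsDesc n = [tier n, …, tier 1]`, where the row of tier `V` is
obtained from the zero row by inserting the items of volumes `1, …, V`. -/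
def rowsDesc : ℕ → List RowRec
  | 0 => []
  | V + 1 => ⟨V + 1, addTier (V + 1) (headRow (rowsDesc V)), tierTriples (V + 1)⟩ :: rowsDesc V

/-- Sum of all knapsack cells, lower volumes first (semantically irrelevant: evaluating it makes the kernel normalise
the rows bottom-up before the search reads them, which keeps the reduction shallow). -/
def rowsSum : List RowRec → ℕ
  | [] => 0
  | r :: rest => rowsSum rest + r.row.foldl (· + ·) 0

/-- A tier of the search list: the volume `V`, the knapsack row for volumes `≤ V`, and the table shapes of volume `V`. -/
structure Tier where
  /-- the common volume of the tier -/ V : ℕ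
  /-- `row_V` -/ row : List ℕ
  /-- the shapes of volume `V` in the table of the current order -/ shapes : List SRec

/-- The shapes of a precomputed tier that pass the table test at order `M`, as records at order `M`. -/
def tierShapes (M : ℕ) (r : RowRec) : List SRec :=
  (r.triples.filter fun t => tableOK M t.1 t.2.1 t.2.2).map fun t => mkRec M t.1 t.2.1 t.2.2

/-- The search list at order `M`: for each precomputed tier of volume `V ≤ M` (descending) with a shape in the order-`M`
table, the tier `⟨V, row_V, shapes⟩`. -/
def mkTiers (M : ℕ) : List RowRec → List Tier
  | [] => []
  | r :: rest =>
    match Nat.ble r.V M, tierShapes M r with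
    | true, s :: sh => ⟨r.V, r.row, s :: sh⟩ :: mkTiers M rest
    | _, _ => mkTiers M rest

/-- Search state of a partial family: `P = Σ ab`, `Q = Σ bc`, `R = Σ ca`, the maximal sharpened U14 offsets, the minimal
sizes (default `M` for the empty family), the value sum `Σ q`, and the member shapes (most recent first). -/
structure St where
  /-- `Σ ab` -/ P : ℕ
  /-- `Σ bc` -/ Q : ℕ
  /-- `Σ ca` -/ R : ℕ
  /-- `max dab` -/ Dab : ℕ
  /-- `max dbc` -/ Dbc : ℕ
  /-- `max dca` -/ Dca : ℕ
  /-- `min a` (default `M`) -/ mA : ℕ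
  /-- `min b` (default `M`) -/ mB : ℕ
  /-- `min c` (default `M`) -/ mC : ℕ
  /-- `Σ q` -/ sq : ℕ
  /-- the members chosen so far -/ fam : List (ℕ × ℕ × ℕ)

/-- The state of the empty family at order `M`. -/
def emptySt (M : ℕ) : St := ⟨0, 0, 0, 0, 0, 0, M, M, M, 0, []⟩

/-- Add the member `s` to a state (`max x y = x + (y - x)`, `min x y = x - (x - y)`, branch-free). -/
def upd (st : St) (s : SRec) : St where
  P := st.P + s.u
  Q := st.Q + s.v
  R := st.R + s.w
  Dab := st.Dab + (s.dab - st.Dab)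
  Dbc := st.Dbc + (s.dbc - st.Dbc)
  Dca := st.Dca + (s.dca - st.Dca)
  mA := st.mA - (st.mA - s.a)
  mB := st.mB - (st.mB - s.b)
  mC := st.mC - (st.mC - s.c)
  sq := st.sq + s.q
  fam := (s.a, s.b, s.c) :: st.fam

/-- The state of a list of members (most recent first). -/
def stOf (M : ℕ) (H : List (ℕ × ℕ × ℕ)) : St :=
  H.foldr (fun t st => upd st (mkRec M t.1 t.2.1 t.2.2)) (emptySt M)

/-- The node filter (O3), as «sum of excesses = 0»: U2 `P, Q, R ≤ M`; U11 per member `P + R ≤ M + min a`,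
`P + Q ≤ M + min b`, `Q + R ≤ M + min c`; sharpened U14 `Dab + P ≤ M`, `Dbc + Q ≤ M`, `Dca + R ≤ M`. -/
def okSt (M : ℕ) (st : St) : Bool :=
  Nat.beq ((st.P - M) + (st.Q - M) + (st.R - M) + (st.P + st.R - (M + st.mA)) + (st.P + st.Q - (M + st.mB)) +
    (st.Q + st.R - (M + st.mC)) + (st.Dab + st.P - M) + (st.Dbc + st.Q - M) + (st.Dca + st.R - M)) 0

/-- The completion budget (O4): an upper bound for the total pair-product sum `ΔP + ΔQ + ΔR` of any admissible
extension, from `ΔP ≤ M - Dab - P` (U14), `ΔP + ΔR ≤ M + min a - (P + R)` (U11) and rotations; the minimum of the five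
resulting linear bounds (`min x y` written `x - (x - y)`). -/
def budget (M : ℕ) (st : St) : ℕ :=
  let p₁ := M - (st.Dab + st.P)
  let q₁ := M - (st.Dbc + st.Q)
  let r₁ := M - (st.Dca + st.R)
  let α := M + st.mA - (st.P + st.R)
  let β := M + st.mB - (st.P + st.Q)
  let γ := M + st.mC - (st.Q + st.R)
  let m₁ := (p₁ + q₁ + r₁) - ((p₁ + q₁ + r₁) - (α + β + γ) / 2)
  let m₂ := (p₁ + γ) - ((p₁ + γ) - (q₁ + α))
  let m₃ := m₁ - (m₁ - m₂)
  m₃ - (m₃ - (r₁ + β))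

/-- The completion test at a node against the knapsack row of a volume bounding all remaining candidates:
`true` = no admissible extension can beat. -/
def breakTest (M : ℕ) (st : St) (row : List ℕ) : Bool :=
  match row[budget M st]? with
  | some x => Nat.ble (st.sq + x) (K * M)
  | none => false

/-- A further member of volume `V` is only possible if `V + P ≤ M`, `V + Q ≤ M`, `V + R ≤ M` (U14 at that member). -/
def eligible (M : ℕ) (st : St) (V : ℕ) : Bool :=
  Nat.beq ((V + st.P - M) + (V + st.Q - M) + (V + st.R - M)) 0

/-- The registered residual multisets of the crux `ShapeExclusionTE`, per order. -/
def residLists (M : ℕ) : List (List (ℕ × ℕ × ℕ)) :=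
  if M = 111 then [[(4,4,4),(4,4,4),(4,4,4),(3,3,3)]]
  else if M = 120 ∨ M = 121 then
    [[(4,4,4),(4,4,4),(4,4,4),(4,4,3)], [(4,4,4),(4,4,4),(4,4,4),(4,3,4)], [(4,4,4),(4,4,4),(4,4,4),(3,4,4)]]
  else if M = 124 then
    [[(5,4,3),(3,4,5),(4,4,4),(4,4,4)], [(5,3,4),(3,5,4),(4,4,4),(4,4,4)], [(4,5,3),(4,3,5),(4,4,4),(4,4,4)],
      [(4,4,4),(4,4,4),(4,4,4),(4,4,4)]]
  else if M = 125 then [[(4,4,4),(4,4,4),(4,4,4),(4,4,4)], [(5,5,3),(5,3,5),(3,5,5),(3,3,3)]]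
  else if M = 126 ∨ M = 127 then [[(4,4,4),(4,4,4),(4,4,4),(4,4,4)]]
  else []

/-- Number of occurrences of `x` in a list of shapes. -/
def cnt (x : ℕ × ℕ × ℕ) : List (ℕ × ℕ × ℕ) → ℕ
  | [] => 0
  | y :: l => cnt x l + (if y = x then 1 else 0)

/-- `L` is a sub-multiset of `fam` (by counting). -/
def subCount (L fam : List (ℕ × ℕ × ℕ)) : Bool := L.all fun x => Nat.ble (cnt x L) (cnt x fam)

/-- The family contains a residual multiset registered for order `M` (O5). -/
def resid (M : ℕ) (fam : List (ℕ × ℕ × ℕ)) : Bool := (residLists M).any fun L => subCount L fam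

/-- Scan the remaining shapes of the current tier at a node with state `st`: each shape passing the filter spawns the
child node `nd` (whose own candidates start at that shape); `rest` is the (lazily evaluated) result for the later
tiers. -/
def scanShapes (M : ℕ) (nd : St → List ℕ → List SRec → List Tier → Bool) (st : St) (row : List ℕ)
    (T : List Tier) (rest : Bool) : List SRec → Bool
  | [] => rest
  | s :: sh => (if okSt M (upd st s) then nd (upd st s) row (s :: sh) T else true) && scanShapes M nd st row T rest sh

/-- Scan the later tiers at a node: at each tier header, stop (success) if the completion bound shows that no
extension beats; skip the tier if its volume is not eligible; else scan its shapes. -/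
def scanTiers (M : ℕ) (nd : St → List ℕ → List SRec → List Tier → Bool) (st : St) : List Tier → Bool
  | [] => true
  | t :: T =>
    breakTest M st t.row ||
      (if eligible M st t.V then scanShapes M nd st t.row T (scanTiers M nd st T) t.shapes else scanTiers M nd st T)

/-- A search node (fuel first; `row` = knapsack row of the current tier, `cur` = remaining shapes of the current tier,
`T` = later tiers): a family whose value sum exceeds `K · M` must contain a residual; otherwise, unless the completion
bound already excludes every extension, scan the extensions. -/
def node (M : ℕ) : ℕ → St → List ℕ → List SRec → List Tier → Bool
  | 0, _, _, _, _ => false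
  | fuel + 1, st, row, cur, T =>
    if K * M < st.sq then resid M st.fam
    else breakTest M st row || scanShapes M (node M fuel) st row T (scanTiers M (node M fuel) st T) cur

/-- First members are taken with `a ≥ b ≥ c` (coordinate symmetry). -/
def sorted3 (s : SRec) : Bool := Nat.ble s.b s.a && Nat.ble s.c s.b

/-- Try every sorted shape of a tier as the member of maximal volume (its extensions range over the whole tier `all`
and the later tiers `T`). -/
def topShapes (M : ℕ) (row : List ℕ) (all : List SRec) (T : List Tier) : List SRec → Bool
  | [] => true
  | s :: sh => (if sorted3 s then node M (M + 1) (upd (emptySt M) s) row all T else true) && topShapes M row all T sh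

/-- The top level over the tiers whose volume lies in `[lo, hi)` (chunking of one order's certificate). -/
def topScan (M lo hi : ℕ) : List Tier → Bool
  | [] => true
  | t :: T => (if lo ≤ t.V ∧ t.V < hi then topShapes M t.row t.shapes T t.shapes else true) && topScan M lo hi T

/-- The search at order `M` over first members of volume in `[lo, hi)`, given knapsack rows `rows` (which must list
every volume `≤ M`, i.e. `rows = rowsDesc n` with `M ≤ n`). -/
def teRun (M lo hi : ℕ) (rows : List RowRec) : Bool := topScan M lo hi (mkTiers M rows)

/-- The certificate checker for order `M`, first members of volume in `[lo, hi)` (the first conjunct is a tautology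
whose evaluation makes the kernel normalise the rows bottom-up before the search reads them). -/
def teCheck (M lo hi : ℕ) : Bool :=
  let rows := rowsDesc M
  Nat.beq (rowsSum rows) (rowsSum rows) && teRun M lo hi rows

/-- The certificate checker for the orders `lo, …, lo + n - 1` (whole search each), sharing the rows `rowsDesc (lo + n)`. -/
def teBatch (lo n : ℕ) : Bool :=
  let rows := rowsDesc (lo + n)
  Nat.beq (rowsSum rows) (rowsSum rows) && (List.range n).all fun i => teRun (lo + i) 0 (lo + n) rows

/-! ## Semantic side: families as multisets of shapes -/

/-- Volume of a shape `(a, b, c)`. -/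
def vol (t : ℕ × ℕ × ℕ) : ℕ := t.1 * t.2.1 * t.2.2
/-- Pair product `ab`. -/
def uu (t : ℕ × ℕ × ℕ) : ℕ := t.1 * t.2.1
/-- Pair product `bc`. -/
def vv (t : ℕ × ℕ × ℕ) : ℕ := t.2.1 * t.2.2
/-- Pair product `ca`. -/
def ww (t : ℕ × ℕ × ℕ) : ℕ := t.2.2 * t.1
/-- `Σ ab` of a family. -/
def sumP (F : Multiset (ℕ × ℕ × ℕ)) : ℕ := (F.map uu).sum
/-- `Σ bc` of a family. -/
def sumQ (F : Multiset (ℕ × ℕ × ℕ)) : ℕ := (F.map vv).sum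
/-- `Σ ca` of a family. -/
def sumR (F : Multiset (ℕ × ℕ × ℕ)) : ℕ := (F.map ww).sum
/-- `Σ qOf V` of a family (an upper bound for `K · Σ V^{5/6}`). -/
def sumVal (F : Multiset (ℕ × ℕ × ℕ)) : ℕ := (F.map fun t => qOf (vol t)).sum

/-- The arithmetic consequences of `SieveAdmissible M` for a family with at least two members, stated on the multiset of
its shapes: the table test per member, U2, U11 per member, and U14 with its single tightness clauses (three
rotations).  This is the hypothesis of the checker's soundness theorem, not a new claim. -/
def AdmM (M : ℕ) (F : Multiset (ℕ × ℕ × ℕ)) : Prop :=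
  (∀ t ∈ F, 1 ≤ t.1 ∧ 1 ≤ t.2.1 ∧ 1 ≤ t.2.2 ∧ tableOK M t.1 t.2.1 t.2.2 = true) ∧
  (sumP F ≤ M ∧ sumQ F ≤ M ∧ sumR F ≤ M) ∧
  (∀ t ∈ F, sumP F + sumR F ≤ M + t.1 ∧ sumP F + sumQ F ≤ M + t.2.1 ∧ sumQ F + sumR F ≤ M + t.2.2) ∧
  (∀ t ∈ F,
    (vol t + sumP F ≤ M + uu t ∧ (vol t + sumP F = M + uu t → ∃ d, t.2.2 ≤ d ∧ d ∣ vol t ∧ d ∣ M)) ∧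
    (vol t + sumQ F ≤ M + vv t ∧ (vol t + sumQ F = M + vv t → ∃ d, t.1 ≤ d ∧ d ∣ vol t ∧ d ∣ M)) ∧
    (vol t + sumR F ≤ M + ww t ∧ (vol t + sumR F = M + ww t → ∃ d, t.2.1 ≤ d ∧ d ∣ vol t ∧ d ∣ M)))

/-- The family contains (as a sub-multiset) one of the residual multisets registered for order `M`. -/
def ResidualM (M : ℕ) (F : Multiset (ℕ × ℕ × ℕ)) : Prop :=
  ∃ L ∈ residLists M, (L : Multiset (ℕ × ℕ × ℕ)) ≤ F

/-! ## Specification vocabulary of the soundness proofs (checker-internal predicates, no claims) -/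

/-- Pair-product sum `ab + bc + ca` of a shape (the knapsack weight). -/
def us (t : ℕ × ℕ × ℕ) : ℕ := uu t + vv t + ww t

/-- Shapes covered by the row of volume `V`: candidates (sizes `≥ 1`, table test at order `127`) of volume `≤ V`. -/
def Cov (V : ℕ) (t : ℕ × ℕ × ℕ) : Prop :=
  1 ≤ t.1 ∧ 1 ≤ t.2.1 ∧ 1 ≤ t.2.2 ∧ tableOK 127 t.1 t.2.1 t.2.2 = true ∧ vol t ≤ V

/-- `row` dominates the class `C`: every list of shapes in `C` of total weight `≤ b ≤ Bmax` has value `≤ row[b]`. -/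
def Dom (row : List ℕ) (C : ℕ × ℕ × ℕ → Prop) : Prop :=
  ∀ G : List (ℕ × ℕ × ℕ), (∀ t ∈ G, C t) → ∀ b, b ≤ Bmax → (G.map us).sum ≤ b →
    (G.map fun t => qOf (vol t)).sum ≤ row.getD b 0

/-- Well-formed tier lists: full-length dominating rows, shapes of the tier's volume, volumes strictly descending. -/
def TiersOK (T : List Tier) : Prop :=
  (∀ τ ∈ T, τ.row.length = Bmax + 1 ∧ Dom τ.row (Cov τ.V) ∧ ∀ s ∈ τ.shapes, s.V = τ.V) ∧
    T.Pairwise (fun τ τ' => τ'.V < τ.V)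

/-- Every remaining member has its record among the current candidates `cur` or in a later tier of `T`. -/
def Placed (M : ℕ) (Δ : Multiset (ℕ × ℕ × ℕ)) (cur : List SRec) (T : List Tier) : Prop :=
  ∀ t ∈ Δ, mkRec M t.1 t.2.1 t.2.2 ∈ cur ∨ ∃ τ ∈ T, mkRec M t.1 t.2.1 t.2.2 ∈ τ.shapes

/-- Order `M` is covered by accepted chunks: every possible volume of a maximal member lies in one of them. -/
def Covered (M : ℕ) : Prop :=
  ∀ V₁, 1 ≤ V₁ → V₁ ≤ M → ∃ lo hi n, lo ≤ V₁ ∧ V₁ < hi ∧ M ≤ n ∧ teRun M lo hi (rowsDesc n) = true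

end Summit.MatrixMultiplication.MatrixMultiplication.Theorems.TECert
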